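import Literature.Analysis.FluidPDE.ParabolicComparison
import Literature.Analysis.FluidPDE.SwirlTransportProofs
import Literature.Analysis.FluidPDE.AxisymmetricVorticityTransport
import Literature.Analysis.FluidPDE.RadialCalculus
import Literature.Analysis.FluidPDE.TaoClassGlue
import Literature.Analysis.FluidPDE.LeiZhang2017AxisymmetricCriteria
import Mathlib.Analysis.Calculus.LocalExtr.Basic
import HarnessLib

/-!
# The maximum principle for the swirl `Γ = r u_θ` of axisymmetric Navier–Stokes flows

Analysis/FluidPDE proof file (no definitions, no named facts, no `sorry`) on the discharge path of
the named fact `Literature.Analysis.FluidPDE.LeiZhang2017_logModulus_regularity` (Z. Lei,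
Q. S. Zhang, Pacific J. Math. 289 (2017) = arXiv:1505.02628).  The first input of the printed
proof of Cor. 1.3 / Thm. 1.2 (arXiv pp. 3, 7, 8) is the maximum principle for the swirl:

> "One can easily check that `∂ₜΓ + (vʳe_r + vᶻe_z)·∇Γ = (Δ − (2/r)∂ᵣ)Γ` (1.3).  A significant
> consequence of (1.3) is that smooth solutions of the axi-symmetric Navier–Stokes equations
> satisfy the following maximum principle (see, for instance, [CL, HL, CSTY1, NP, NP-2]):
> `sup_t ‖Γ(t, ·)‖_{L^∞} ≤ ‖Γ₀‖_{L^∞}` (1.4)"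

(also Koch–Nadirashvili–Seregin–Šverák 2009, (1.8)–(1.9)).  This file proves (1.4) for classical
solutions on a closed slab `[0, T] × ℝ³` with bounded, axisymmetric velocity — in particular for
the Tao-class solutions in which the tree runs its continuation arguments
(`IsTaoSolutionOn.abs_swirl_le`) — from the swirl equation already in the tree
(`swirl_transport_holds`, KNSS (1.8)) by an elementary comparison argument:

* `weak_max_principle` — the weak parabolic maximum principle in abstract form (Lieberman 1996,
  Ch. II, Lemma 2.1 / Lemma 2.3): on `[T₁, T₂] × K`, `K` compact, a function `w` which is jointly
  continuous, has `C²` slices and a left time derivative `wₜ` at the points of an open `U ⊆ K`,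
  satisfies there the "sub-solution implication" `∇w = 0 ∧ Δw ≤ 0 ⟹ wₜ ≤ 0` (which is what
  `wₜ ≤ νΔw + b·∇w` gives for ANY drift `b`, bounded or not), and is `≤ 0` on the parabolic
  boundary `({T₁} × K) ∪ ([T₁, T₂] × (K ∖ U))`, is `≤ 0` on `[T₁, T₂] × K`;
* `abs_swirl_le_of_classical` — **(1.4)**: for a classical solution of the unforced system
  (`ν > 0`) on `[0, T] × ℝ³` with `|v| ≤ V` and axisymmetric velocity, `|Γ₀| ≤ M` implies
  `|Γ(t, x)| ≤ M` on `[0, T] × ℝ³`;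
* `IsTaoSolutionOn.abs_swirl_le` — the same in Tao's class (the velocity bound is automatic).
* `sign_mul_swirl_le_of_classical_of_nonneg`, `abs_swirl_le_of_classical_of_nonneg` — the same
  statements for ANY `ν ≥ 0`: the comparison argument below uses the viscosity only through
  `ν ≥ 0` (the swirl equation `swirl_transport_holds`, KNSS (1.8), holds for every `ν`), so the
  `ν > 0` theorems are one-line corollaries of these;
* `abs_swirl_le_of_classicalEuler` — the case `ν = 0`: for a classical solution of the unforced
  axisymmetric **Euler** system on `[0, T] × ℝ³` with bounded velocity, `|Γ₀| ≤ M` implies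
  `|Γ(t, x)| ≤ M` — the `L^∞` form of the conservation of the swirl `D̃(r v^θ)/Dt = 0` along
  particle trajectories (Majda–Bertozzi 2002, §2.3.3 (2.65)–(2.67): "conservation of circulation
  on material circles centered on the axis of symmetry").

## The comparison argument

The pressure is an axisymmetric scalar (`IsClassicalNSSolutionOn.isAxisymmetricScalar_pressure`),
so `Γ` satisfies `∂ₜΓ + v·∇Γ = ν(ΔΓ − (2/r)∂ᵣΓ)` off the axis (`swirl_transport_holds`), and
`Γ = 0` on the axis.  Let `h(t, x) = M + c(1 + |x|²)`, `c = ε e^{βt}`, `β = 6ν + V + 1`: then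
`∇h = 2c⟪x, ·⟫`, `Δh = 6c` (`hasFDerivAt_barrier`, `laplacian_barrier`) and
`∂ᵣh = 2c⟪x, e_r⟫ ≥ 0` (`inner_self_eR_nonneg`).  Apply `weak_max_principle` to `w = σΓ − h`,
`σ = ±1`, on `K = B̄(0, R)`, `U = B(0, R) ∖ {axis}`: at a point of `U` with `∇w = 0`, `Δw ≤ 0`
one has `σ∇Γ = ∇h`, `σΔΓ ≤ Δh = 6c`, hence by the swirl equation
`σΓₜ = νσΔΓ − (2ν/r)∂ᵣh − ∇h·v ≤ 6νc + 2cV|x| ≤ (6ν + V) c (1 + |x|²) < βc(1 + |x|²) = hₜ`,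
i.e. `wₜ < 0` (`sign_mul_swirl_le_of_classical`, step (d)); on the parabolic boundary `w ≤ 0`
because `|Γ₀| ≤ M` (`t = 0`), `Γ = 0` (axis) and `|Γ| ≤ 2|x||v| ≤ 2RV ≤ ε(1 + R²)` on
`|x| = R ≥ 2V/ε` (`abs_swirl_le_norm_mul`).  So `σΓ ≤ M + ε e^{βt}(1 + |x|²)` on every large
ball, for every `ε > 0`, whence `σΓ ≤ M`.

## Mathlib / tree search

Tree: `swirl_transport_holds`, `timeDerivWithin_swirl`, `fderiv_swirl_apply`, `contDiff_swirl`
(`SwirlTransportProofs`), `IsClassicalNSSolutionOn.isAxisymmetricScalar_pressure`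
(`AxisymmetricVorticityTransport`), `IsLocalMax.laplacian_nonpos` (`ParabolicComparison`),
`laplacian_comp_norm_sq`, `fderiv_comp_norm_sq_apply` (`RadialCalculus`),
`IsTaoSolutionOn.exists_bound_velocity` (`TaoClassGlue`); the tree's comparison principles
(`driftHeat_comparison`, `paraboloid_comparison`) are for bounded drifts on paraboloids and for
time-integrated supersolutions, not applicable to the singular drift `(2ν/r)e_r`; no maximum
principle for the swirl (`lean search 'abs_swirl_le|swirl_max|swirl.*sup'`).  Mathlib:
`IsLocalMaxOn.hasFDerivWithinAt_nonpos`, `mem_posTangentConeAt_of_segment_subset`,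
`IsCompact.exists_isMaxOn`, `IsLocalMax.fderiv_eq_zero`.

## References

* Z. Lei, Q. S. Zhang, Pacific J. Math. 289 (2017) 169–187, arXiv:1505.02628, §1 (1.3)–(1.4)
  (arXiv p. 3), proof of Cor. 1.3 (p. 7). [`LeiZhang2017`]
* G. Koch, N. Nadirashvili, G. Seregin, V. Šverák, Acta Math. 203 (2009) = arXiv:0709.3599, §1,
  (1.8)–(1.9). [`KochNadirashviliSereginSverak2009`]
* D. Chae, J. Lee, Math. Z. 239 (2002), 645–671, §3 (the `L^p` proof of (1.4)). [`ChaeLee2002`]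
* G. M. Lieberman, *Second order parabolic differential equations*, World Scientific 1996,
  Ch. II, Lemma 2.1, Lemma 2.3. [`Lieberman1996`]
-/

noncomputable section

open MeasureTheory Set Function Filter Topology Metric InnerProductSpace WithLp
open scoped RealInnerProductSpace Laplacian ContDiff NNReal

namespace Literature.Analysis.FluidPDE

/-! ### The weak parabolic maximum principle, abstract form -/

section WeakMax

variable {E : Type*} [NormedAddCommGroup E] [InnerProductSpace ℝ E] [FiniteDimensional ℝ E]

/-- **Weak parabolic maximum principle** (Lieberman 1996, Ch. II, Lemma 2.1 with Lemma 2.3, in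
abstract form).  Let `K` be compact, `U ⊆ K` open, `T₁ ≤ T₂`, and let `w : ℝ → E → ℝ` be jointly
continuous on `[T₁, T₂] × K`, with `C²` slices `w t` for `t ∈ (T₁, T₂]` and a left time derivative
`wₜ t x` (within `[T₁, t]`) at the points of `(T₁, T₂] × U`.  Assume the sub-solution implication
`∇(w t)(x) = 0 → Δ(w t)(x) ≤ 0 → wₜ t x ≤ 0` on `(T₁, T₂] × U` (as furnished by any differential
inequality `wₜ ≤ νΔw + b·∇w`, `ν ≥ 0`, whatever the drift `b`), and `w ≤ 0` on the parabolic
boundary: at `t = T₁` on `K`, and on `[T₁, T₂] × (K ∖ U)`.  Then `w ≤ 0` on `[T₁, T₂] × K`.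
Proof: a positive value forces a positive maximum of `w − θ(t − T₁)` (small `θ > 0`) on the
compact `[T₁, T₂] × K`, off the parabolic boundary; there `∇w = 0`, `Δw ≤ 0` and the left
derivative gives `wₜ ≥ θ > 0`, contradicting the implication. [cite: Lieberman1996, Ch. II Lemma 2.1 and Lemma 2.3] -/
theorem weak_max_principle {K U : Set E} (hK : IsCompact K) (hU : IsOpen U) (hUK : U ⊆ K)
    {T₁ T₂ : ℝ} {w wₜ : ℝ → E → ℝ}
    (hc : ContinuousOn (uncurry w) (Icc T₁ T₂ ×ˢ K))
    (h2 : ∀ t ∈ Ioc T₁ T₂, ContDiff ℝ 2 (w t))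
    (ht : ∀ t ∈ Ioc T₁ T₂, ∀ x ∈ U, HasDerivWithinAt (fun s => w s x) (wₜ t x) (Icc T₁ t) t)
    (hsub : ∀ t ∈ Ioc T₁ T₂, ∀ x ∈ U, fderiv ℝ (w t) x = 0 → (Δ (w t)) x ≤ 0 → wₜ t x ≤ 0)
    (hbot : ∀ x ∈ K, w T₁ x ≤ 0)
    (hlat : ∀ t ∈ Icc T₁ T₂, ∀ x ∈ K \ U, w t x ≤ 0) :
    ∀ t ∈ Icc T₁ T₂, ∀ x ∈ K, w t x ≤ 0 := by
  by_contra H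
  push Not at H
  obtain ⟨t₀, ht₀, x₀, hx₀, hpos⟩ := H
  -- the perturbation `θ (t - T₁)`
  set δ : ℝ := w t₀ x₀ with hδ
  set θ : ℝ := δ / (2 * (T₂ - T₁ + 1)) with hθ
  have hT : T₁ ≤ T₂ := ht₀.1.trans ht₀.2
  have hθpos : 0 < θ := div_pos hpos (by linarith)
  have hθδ : θ * (t₀ - T₁) < δ := by
    have h1 : θ * (t₀ - T₁) ≤ θ * (T₂ - T₁ + 1) :=
      mul_le_mul_of_nonneg_left (by linarith [ht₀.2]) hθpos.le
    have h2 : θ * (T₂ - T₁ + 1) = δ / 2 := by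
      rw [hθ, div_mul_eq_mul_div, mul_div_mul_right _ _ (by linarith : (T₂ - T₁ + 1) ≠ 0)]
    linarith
  -- a maximum point of `g = w - θ (t - T₁)` on the compact `[T₁, T₂] × K`
  set S : Set (ℝ × E) := Icc T₁ T₂ ×ˢ K with hS
  have hSc : IsCompact S := isCompact_Icc.prod hK
  set g : ℝ × E → ℝ := fun p => w p.1 p.2 - θ * (p.1 - T₁) with hg
  have hgc : ContinuousOn g S := by
    have h3 : Continuous fun p : ℝ × E => θ * (p.1 - T₁) := by fun_prop
    exact hc.sub h3.continuousOn
  obtain ⟨⟨t', x'⟩, ⟨ht', hx'⟩, hmax⟩ := hSc.exists_isMaxOn ⟨(t₀, x₀), ht₀, hx₀⟩ hgc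
  simp only at ht' hx'
  have hmax' : ∀ t ∈ Icc T₁ T₂, ∀ x ∈ K, w t x - θ * (t - T₁) ≤ w t' x' - θ * (t' - T₁) :=
    fun t ht x hx => hmax (show (t, x) ∈ S from ⟨ht, hx⟩)
  have hgpos : 0 < w t' x' - θ * (t' - T₁) := by
    have := hmax' t₀ ht₀ x₀ hx₀
    linarith
  have hwpos : 0 < w t' x' := by
    have : 0 ≤ θ * (t' - T₁) := mul_nonneg hθpos.le (by linarith [ht'.1])
    linarith
  -- the maximum point is off the parabolic boundary
  have ht'1 : T₁ < t' := by
    rcases eq_or_lt_of_le ht'.1 with h | h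
    · exfalso
      have hb := hbot x' hx'
      rw [h] at hb
      linarith
    · exact h
  have hx'U : x' ∈ U := by
    by_contra hxU
    have hl := hlat t' ht' x' ⟨hx', hxU⟩
    linarith
  have ht'I : t' ∈ Ioc T₁ T₂ := ⟨ht'1, ht'.2⟩
  -- first- and second-order conditions in space
  have hloc : IsLocalMax (w t') x' := by
    filter_upwards [hU.mem_nhds hx'U] with x hx
    have := hmax' t' ht' x (hUK hx)
    linarith
  have hgrad : fderiv ℝ (w t') x' = 0 := hloc.fderiv_eq_zero
  have hlap : (Δ (w t')) x' ≤ 0 := IsLocalMax.laplacian_nonpos (h2 t' ht'I) hloc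
  have hwt : wₜ t' x' ≤ 0 := hsub t' ht'I x' hx'U hgrad hlap
  -- the left time derivative of `g (·, x')` at `t'` is nonnegative
  have hderiv : HasDerivWithinAt (fun s => w s x' - θ * (s - T₁)) (wₜ t' x' - θ) (Icc T₁ t') t' := by
    have h1 := ht t' ht'I x' hx'U
    have h2 : HasDerivWithinAt (fun s : ℝ => θ * (s - T₁)) θ (Icc T₁ t') t' := by
      have := ((hasDerivAt_id t').sub_const T₁).const_mul θ
      simpa using this.hasDerivWithinAt
    exact h1.sub h2
  have hmaxOn : IsLocalMaxOn (fun s => w s x' - θ * (s - T₁)) (Icc T₁ t') t' :=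
    Filter.eventually_of_mem self_mem_nhdsWithin fun s hs =>
      hmax' s ⟨hs.1, hs.2.trans ht'.2⟩ x' hx'
  have hcone : T₁ - t' ∈ posTangentConeAt (Icc T₁ t') t' := by
    have hseg : segment ℝ t' T₁ ⊆ Icc T₁ t' := by
      rw [segment_symm, segment_eq_Icc ht'1.le]
    exact sub_mem_posTangentConeAt_of_segment_subset hseg
  have key : (T₁ - t') * (wₜ t' x' - θ) ≤ 0 := by
    simpa using hmaxOn.hasFDerivWithinAt_nonpos hderiv.hasFDerivWithinAt hcone
  -- `(T₁ - t') (wₜ - θ) ≤ 0` with `T₁ - t' < 0` forces `wₜ ≥ θ > 0`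
  have hneg : T₁ - t' < 0 := by linarith
  have : 0 ≤ wₜ t' x' - θ := by
    by_contra hcon
    push Not at hcon
    have := mul_pos_of_neg_of_neg hneg hcon
    linarith
  linarith

end WeakMax

/-! ### The barrier `M + c (1 + |x|²)` -/

section Barrier

/-- Gradient of the barrier: `D(M + c(1 + |·|²))(x) = c · 2⟪x, ·⟫`. [folklore] -/
theorem hasFDerivAt_barrier (M c : ℝ) (x : (EuclideanSpace ℝ (Fin 3))) :
    HasFDerivAt (fun y : (EuclideanSpace ℝ (Fin 3)) => M + c * (1 + ‖y‖ ^ 2))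
      (c • ((2 : ℕ) • (innerSL ℝ x : (EuclideanSpace ℝ (Fin 3)) →L[ℝ] ℝ))) x :=
  ((((hasStrictFDerivAt_norm_sq x).hasFDerivAt).const_add 1).const_mul c).const_add M

/-- The barrier is smooth. [folklore] -/
theorem contDiff_barrier (M c : ℝ) {n : WithTop ℕ∞} :
    ContDiff ℝ n (fun y : (EuclideanSpace ℝ (Fin 3)) => M + c * (1 + ‖y‖ ^ 2)) :=
  contDiff_const.add (contDiff_const.mul (contDiff_const.add (contDiff_norm_sq ℝ)))

/-- Laplacian of the barrier: `Δ(M + c(1 + |·|²)) = 6c` on `ℝ³`. [folklore] -/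
theorem laplacian_barrier (M c : ℝ) (x : (EuclideanSpace ℝ (Fin 3))) :
    (Δ (fun y : (EuclideanSpace ℝ (Fin 3)) => (M + c * (1 + ‖y‖ ^ 2) : ℝ))) x = 6 * c := by
  have hg : ∀ σ ∈ (univ : Set ℝ), HasDerivAt (fun σ : ℝ => M + c * (1 + σ)) c σ := fun σ _ => by
    have h := (((hasDerivAt_id σ).const_add 1).const_mul c).const_add M
    simpa using h
  have h := laplacian_comp_norm_sq (E := (EuclideanSpace ℝ (Fin 3))) (g := fun σ : ℝ => M + c * (1 + σ))
    (g₁ := fun _ => c) (g₂ := 0) isOpen_univ hg (mem_univ (‖x‖ ^ 2)) (hasDerivAt_const _ _)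
  rw [finrank_euclideanSpace_fin] at h
  rw [h]
  push_cast
  ring

end Barrier

/-! ### The maximum principle for the swirl -/

section Swirl

/-- The zero force is axisymmetric. [folklore] -/
theorem isAxisymmetric_zero : IsAxisymmetric (0 : (EuclideanSpace ℝ (Fin 3)) → (EuclideanSpace ℝ (Fin 3))) := by
  intro θ x
  ext i
  fin_cases i <;> simp

/-- `⟪x, e_r(x)⟫ ≥ 0` (it equals `r`). [folklore] -/
theorem inner_self_eR_nonneg (x : (EuclideanSpace ℝ (Fin 3))) : 0 ≤ ⟪x, eR x⟫ := by
  rw [eR, real_inner_smul_right]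
  refine mul_nonneg (inv_nonneg.2 (cylRadius_nonneg x)) ?_
  have h : ⟪x, toLp 2 ![x 0, x 1, 0]⟫ = x 0 * x 0 + x 1 * x 1 := by
    simp [PiLp.inner_apply, Fin.sum_univ_three]
  rw [h]
  nlinarith [sq_nonneg (x 0), sq_nonneg (x 1)]

/-- **One-sided comparison for the swirl, any `ν ≥ 0`** (the heart of the maximum principle
(1.4) of Lei–Zhang 2017 / KNSS 2009 (1.9), and of the conservation of the swirl for Euler flows,
Majda–Bertozzi (2.67)): for a classical solution of the unforced system with viscosity `ν ≥ 0` on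
`[0, T] × ℝ³` with bounded (`|v| ≤ V`) axisymmetric velocity and `|Γ₀| ≤ M`, for a sign `σ = ±1`,
`σ Γ(t, x) ≤ M` on `[0, T] × ℝ³`.  See the module docstring for the barrier argument; the
viscosity enters only through `ν ≥ 0` (the terms `νσΔΓ ≤ 6νc` and `(2ν/r)∂ᵣh ≥ 0`).
[cite: LeiZhang2017, §1 (1.3)–(1.4) (arXiv p. 3); MajdaBertozziCUP2002, §2.3.3 (2.65)–(2.67)] -/
theorem sign_mul_swirl_le_of_classical_of_nonneg {T ν V M : ℝ} {v : ℝ → (EuclideanSpace ℝ (Fin 3)) → (EuclideanSpace ℝ (Fin 3))} {q : ℝ → (EuclideanSpace ℝ (Fin 3)) → ℝ}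
    (hν : 0 ≤ ν) (hT : 0 < T) (hcl : IsClassicalNSSolutionOn (Icc 0 T) ν 0 v q)
    (haxi : ∀ t ∈ Icc 0 T, IsAxisymmetric (v t)) (hV : ∀ t ∈ Icc 0 T, ∀ x, ‖v t x‖ ≤ V)
    (hM : ∀ x, |swirl (v 0) x| ≤ M) {σ : ℝ} (hσ : σ = 1 ∨ σ = -1) :
    ∀ t ∈ Icc 0 T, ∀ x, σ * swirl (v t) x ≤ M := by
  have hV0 : 0 ≤ V := (norm_nonneg _).trans (hV 0 ⟨le_rfl, hT.le⟩ 0)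
  have hσabs : ∀ a : ℝ, σ * a ≤ |a| := fun a => by
    rcases hσ with h | h
    · rw [h, one_mul]; exact le_abs_self a
    · rw [h, neg_one_mul]; exact neg_le_abs a
  have hσ1 : |σ| = 1 := by rcases hσ with h | h <;> simp [h]
  -- the pressure is axisymmetric, so the swirl equation holds off the axis
  have hp : ∀ t ∈ Icc 0 T, IsAxisymmetricScalar (q t) := fun t ht =>
    hcl.isAxisymmetricScalar_pressure (uniqueDiffOn_Icc hT) haxi (fun _ _ => isAxisymmetric_zero) ht
  -- constants of the barrier
  set β : ℝ := 6 * ν + V + 1 with hβ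
  have hβ0 : 0 ≤ β := by rw [hβ]; positivity
  -- the claim for every `ε > 0`, on every large ball
  suffices key : ∀ ε : ℝ, 0 < ε → ∀ R : ℝ, 2 * V / ε ≤ R →
      ∀ t ∈ Icc 0 T, ∀ x ∈ closedBall (0 : (EuclideanSpace ℝ (Fin 3))) R,
        σ * swirl (v t) x - (M + ε * Real.exp (β * t) * (1 + ‖x‖ ^ 2)) ≤ 0 by
    intro t ht x
    refine le_of_forall_pos_le_add fun η hη => ?_
    set C : ℝ := Real.exp (β * t) * (1 + ‖x‖ ^ 2) with hC
    have hCpos : 0 < C := by positivity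
    have h := key (η / C) (div_pos hη hCpos) (max (2 * V / (η / C)) ‖x‖) (le_max_left _ _) t ht x
      (mem_closedBall_zero_iff.2 (le_max_right _ _))
    have e : η / C * Real.exp (β * t) * (1 + ‖x‖ ^ 2) = η := by
      rw [hC]; field_simp
    rw [e] at h
    linarith
  intro ε hε R hR
  have hR0 : 0 ≤ R := le_trans (by positivity) hR
  -- the comparison function
  set w : ℝ → (EuclideanSpace ℝ (Fin 3)) → ℝ := fun t x =>
    σ * swirl (v t) x - (M + ε * Real.exp (β * t) * (1 + ‖x‖ ^ 2)) with hw
  set Γₜ : ℝ → (EuclideanSpace ℝ (Fin 3)) → ℝ := fun t x => timeDerivWithin (Icc 0 T) (fun s => swirl (v s)) t x with hΓₜ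
  set wₜ : ℝ → (EuclideanSpace ℝ (Fin 3)) → ℝ := fun t x =>
    σ * Γₜ t x - β * (ε * Real.exp (β * t) * (1 + ‖x‖ ^ 2)) with hwₜ
  set K : Set (EuclideanSpace ℝ (Fin 3)) := closedBall 0 R with hK
  set U : Set (EuclideanSpace ℝ (Fin 3)) := ball 0 R ∩ {x | cylRadius x ≠ 0} with hU
  have hKc : IsCompact K := isCompact_closedBall _ _
  have hUo : IsOpen U := isOpen_ball.inter (isOpen_ne_fun continuous_cylRadius continuous_const)
  have hUK : U ⊆ K := fun x hx => ball_subset_closedBall hx.1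
  -- regularity of the velocity
  have hsm := hcl.smooth_velocity
  have hvC2 : ∀ t ∈ Icc 0 T, ContDiff ℝ 2 (v t) := fun t ht =>
    (hcl.contDiff_velocity ht).of_le (by norm_cast)
  have hvd : ∀ t ∈ Icc 0 T, ∀ x, DifferentiableAt ℝ (v t) x := fun t ht x =>
    ((hvC2 t ht).of_le one_le_two).differentiable one_ne_zero x
  -- (a) joint continuity
  have hc : ContinuousOn (uncurry w) (Icc 0 T ×ˢ K) := by
    have hvc : ContinuousOn (uncurry v) (Icc 0 T ×ˢ K) :=
      hsm.continuousOn.mono (prod_mono Subset.rfl (subset_univ _))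
    have h1 : ContinuousOn (fun p : ℝ × (EuclideanSpace ℝ (Fin 3)) => ⟪rotGenL p.2, uncurry v p⟫) (Icc 0 T ×ˢ K) :=
      (rotGenL.continuous.comp continuous_snd).continuousOn.inner hvc
    have h2 : Continuous fun p : ℝ × (EuclideanSpace ℝ (Fin 3)) => M + ε * Real.exp (β * p.1) * (1 + ‖p.2‖ ^ 2) := by
      fun_prop
    refine (((continuousOn_const (c := σ)).mul h1).sub h2.continuousOn).congr fun p _ => ?_
    simp only [hw, uncurry, rotGenL_apply, swirl_eq_inner_rotGen, Pi.sub_apply, Pi.mul_apply]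
  -- (b) smooth slices
  have h2 : ∀ t ∈ Ioc 0 T, ContDiff ℝ 2 (w t) := fun t ht =>
    (contDiff_const.mul (contDiff_swirl (hvC2 t ⟨ht.1.le, ht.2⟩))).sub
      (contDiff_barrier M (ε * Real.exp (β * t)))
  -- (c) the left time derivative
  have ht : ∀ t ∈ Ioc 0 T, ∀ x ∈ U, HasDerivWithinAt (fun s => w s x) (wₜ t x) (Icc 0 t) t := by
    intro t ht x _
    have htI : t ∈ Icc 0 T := ⟨ht.1.le, ht.2⟩
    have hΓ : HasDerivWithinAt (fun s => swirl (v s) x) (Γₜ t x) (Icc 0 T) t := by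
      have hd : DifferentiableWithinAt ℝ (fun s => swirl (v s) x) (Icc 0 T) t := by
        have h1 := hsm.differentiableWithinAt_time htI x
        simp only [swirl_eq_inner_rotGen]
        exact (differentiableWithinAt_const _).inner ℝ h1
      have := hd.hasDerivWithinAt
      simp only [hΓₜ, timeDerivWithin_apply]
      exact this
    have hexp : HasDerivWithinAt (fun s => M + ε * Real.exp (β * s) * (1 + ‖x‖ ^ 2))
        (ε * (Real.exp (β * t) * β) * (1 + ‖x‖ ^ 2)) (Icc 0 T) t := by
      have h1 : HasDerivAt (fun s => Real.exp (β * s)) (Real.exp (β * t) * β) t := by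
        have := ((hasDerivAt_id t).const_mul β).exp
        simpa using this
      exact (((h1.const_mul ε).mul_const (1 + ‖x‖ ^ 2)).const_add M).hasDerivWithinAt
    have h := ((hΓ.const_mul σ).sub hexp).mono (Icc_subset_Icc_right ht.2)
    simp only [hw, hwₜ]
    exact h.congr_deriv (by ring)
  -- (d) the sub-solution implication, from the swirl equation
  have hsub : ∀ t ∈ Ioc 0 T, ∀ x ∈ U, fderiv ℝ (w t) x = 0 → (Δ (w t)) x ≤ 0 → wₜ t x ≤ 0 := by
    intro t ht x hx hgrad hlap
    have htI : t ∈ Icc 0 T := ⟨ht.1.le, ht.2⟩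
    have hr : cylRadius x ≠ 0 := hx.2
    have hr0 : 0 < cylRadius x := lt_of_le_of_ne (cylRadius_nonneg x) (Ne.symm hr)
    set c : ℝ := ε * Real.exp (β * t) with hc
    have hc0 : 0 < c := by positivity
    -- the swirl equation at `(t, x)`
    have hpde := swirl_transport_holds hcl haxi hp htI hr
    have hf0 : swirl ((0 : ℝ → (EuclideanSpace ℝ (Fin 3)) → (EuclideanSpace ℝ (Fin 3))) t) x = 0 := by simp [swirl]
    rw [hf0, add_zero, convect_apply, partialDeriv_apply] at hpde
    -- derivatives of the two parts of `w t`
    have hΓd : DifferentiableAt ℝ (swirl (v t)) x := differentiableAt_swirl (hvd t htI x)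
    have hB := hasFDerivAt_barrier M c x
    have hwderiv : HasFDerivAt (w t) (σ • fderiv ℝ (swirl (v t)) x -
        c • ((2 : ℕ) • (innerSL ℝ x : (EuclideanSpace ℝ (Fin 3)) →L[ℝ] ℝ))) x := by
      have h := (hΓd.hasFDerivAt.const_mul σ).sub hB
      simp only [hw, hc]
      exact h
    have hDeq : σ • fderiv ℝ (swirl (v t)) x = c • ((2 : ℕ) • (innerSL ℝ x : (EuclideanSpace ℝ (Fin 3)) →L[ℝ] ℝ)) := by
      have := hwderiv.fderiv
      rw [hgrad] at this
      exact (sub_eq_zero.1 this.symm)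
    have hDapply : ∀ a : (EuclideanSpace ℝ (Fin 3)), σ * fderiv ℝ (swirl (v t)) x a = c * (2 * ⟪x, a⟫) := fun a => by
      have := congrArg (fun L : (EuclideanSpace ℝ (Fin 3)) →L[ℝ] ℝ => L a) hDeq
      simpa [innerSL_apply_apply, nsmul_eq_mul] using this
    -- Laplacians
    have hΔeq : (Δ (w t)) x = σ * (Δ (swirl (v t))) x - 6 * c := by
      have h1 : ContDiffAt ℝ 2 (fun y => σ * swirl (v t) y) x :=
        (contDiff_const.mul (contDiff_swirl (hvC2 t htI))).contDiffAt
      have h2 : ContDiffAt ℝ 2 (fun y : (EuclideanSpace ℝ (Fin 3)) => (M + c * (1 + ‖y‖ ^ 2) : ℝ)) x :=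
        (contDiff_barrier M c).contDiffAt
      have h3 : (Δ (fun y => σ * swirl (v t) y)) x = σ * (Δ (swirl (v t))) x := by
        have : (fun y => σ * swirl (v t) y) = σ • swirl (v t) := by
          funext y; simp [smul_eq_mul]
        rw [this, laplacian_smul σ ((contDiff_swirl (hvC2 t htI)).contDiffAt), smul_eq_mul]
      have h4 := h1.laplacian_sub h2
      have hfun : w t = (fun y => σ * swirl (v t) y) - fun y : (EuclideanSpace ℝ (Fin 3)) => (M + c * (1 + ‖y‖ ^ 2) : ℝ) := by
        funext y
        simp only [hw, hc, Pi.sub_apply]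
      rw [hfun, h4, h3, laplacian_barrier]
    have hΔ : σ * (Δ (swirl (v t))) x ≤ 6 * c := by
      rw [hΔeq] at hlap; linarith
    -- the drift terms at the critical point
    have hrad : 0 ≤ c * (2 * ⟪x, eR x⟫) := by
      have := inner_self_eR_nonneg x
      positivity
    have hconv : -(c * (2 * ⟪x, v t x⟫)) ≤ c * (2 * (‖x‖ * V)) := by
      have h1 : |⟪x, v t x⟫| ≤ ‖x‖ * ‖v t x‖ := abs_real_inner_le_norm _ _
      have h2 : ‖x‖ * ‖v t x‖ ≤ ‖x‖ * V := mul_le_mul_of_nonneg_left (hV t htI x) (norm_nonneg _)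
      have h3 := (abs_le.1 (h1.trans h2)).1
      nlinarith
    -- `σ Γₜ ≤ 6 ν c + 2 c V |x|`
    have hΓeq : Γₜ t x = ν * ((Δ (swirl (v t))) x - 2 / cylRadius x * fderiv ℝ (swirl (v t)) x (eR x)) -
        fderiv ℝ (swirl (v t)) x (v t x) := by
      have := eq_sub_of_add_eq hpde
      simpa [hΓₜ] using this
    have hΓt : σ * Γₜ t x ≤ ν * (6 * c) + c * (2 * (‖x‖ * V)) := by
      have e : σ * Γₜ t x = ν * (σ * (Δ (swirl (v t))) x) -
          ν * (2 / cylRadius x) * (σ * fderiv ℝ (swirl (v t)) x (eR x)) -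
          σ * fderiv ℝ (swirl (v t)) x (v t x) := by
        rw [hΓeq]; ring
      rw [e, hDapply (eR x), hDapply (v t x)]
      have h1 : ν * (σ * (Δ (swirl (v t))) x) ≤ ν * (6 * c) :=
        mul_le_mul_of_nonneg_left hΔ hν
      have h2 : 0 ≤ ν * (2 / cylRadius x) * (c * (2 * ⟪x, eR x⟫)) := by
        have := inner_self_eR_nonneg x
        positivity
      linarith
    -- conclude: `wₜ ≤ (6ν + V - β) c (1 + |x|²) ≤ 0`
    set A : ℝ := c * (1 + ‖x‖ ^ 2) with hA
    have hA0 : 0 ≤ A := by positivity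
    have hx2 : 2 * (‖x‖ * V) ≤ V * (1 + ‖x‖ ^ 2) := by
      nlinarith [sq_nonneg (‖x‖ - 1), norm_nonneg x]
    have hx2' : c * (2 * (‖x‖ * V)) ≤ V * A := by
      calc c * (2 * (‖x‖ * V)) ≤ c * (V * (1 + ‖x‖ ^ 2)) := mul_le_mul_of_nonneg_left hx2 hc0.le
        _ = V * A := by rw [hA]; ring
    have h6 : ν * (6 * c) ≤ 6 * ν * A := by
      have hpos : 0 ≤ ν * c * ‖x‖ ^ 2 := by positivity
      have e : 6 * ν * A - ν * (6 * c) = 6 * (ν * c * ‖x‖ ^ 2) := by rw [hA]; ring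
      linarith
    have e1 : (6 * ν + V) * A = 6 * ν * A + V * A := by ring
    have e2 : β * A = (6 * ν + V) * A + A := by rw [hβ]; ring
    have e3 : wₜ t x = σ * Γₜ t x - β * A := by
      simp only [hwₜ, hA, hc]
    rw [e3]
    linarith
  -- (e) the parabolic boundary: `t = 0`
  have hbot : ∀ x ∈ K, w 0 x ≤ 0 := by
    intro x _
    simp only [hw, mul_zero, Real.exp_zero, mul_one]
    have h1 := hσabs (swirl (v 0) x)
    have h2 := hM x
    have h3 : 0 ≤ ε * (1 + ‖x‖ ^ 2) := by positivity
    linarith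
  -- (f) the parabolic boundary: the axis and the sphere `|x| = R`
  have hlat : ∀ t ∈ Icc 0 T, ∀ x ∈ K \ U, w t x ≤ 0 := by
    intro t ht x hx
    have hM0 : 0 ≤ M := (abs_nonneg _).trans (hM 0)
    have hexp1 : 1 ≤ Real.exp (β * t) := Real.one_le_exp (mul_nonneg hβ0 ht.1)
    have hH : ε * (1 + ‖x‖ ^ 2) ≤ ε * Real.exp (β * t) * (1 + ‖x‖ ^ 2) := by
      have : ε * (1 + ‖x‖ ^ 2) * 1 ≤ ε * (1 + ‖x‖ ^ 2) * Real.exp (β * t) :=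
        mul_le_mul_of_nonneg_left hexp1 (by positivity)
      linarith
    have hxK : ‖x‖ ≤ R := mem_closedBall_zero_iff.1 hx.1
    simp only [hw]
    by_cases hax : cylRadius x = 0
    · -- on the axis the swirl vanishes
      rw [swirl_eq_zero_of_cylRadius_eq_zero (v t) hax, mul_zero]
      have : 0 ≤ ε * Real.exp (β * t) * (1 + ‖x‖ ^ 2) := by positivity
      linarith
    · -- on the sphere `|x| = R ≥ 2V/ε`
      have hxR : ‖x‖ = R := by
        have hnot : x ∉ ball (0 : (EuclideanSpace ℝ (Fin 3))) R := fun hb => hx.2 ⟨hb, hax⟩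
        have : R ≤ ‖x‖ := by simpa using hnot
        exact le_antisymm hxK this
      have h1 : σ * swirl (v t) x ≤ 2 * R * V := by
        refine (hσabs _).trans ?_
        calc |swirl (v t) x| ≤ 2 * ‖x‖ * ‖v t x‖ := abs_swirl_le_norm_mul (v t) x
          _ ≤ 2 * R * V := by
            rw [hxR]
            exact mul_le_mul_of_nonneg_left (hV t ht x) (by positivity)
      have h2 : 2 * R * V ≤ ε * (1 + ‖x‖ ^ 2) := by
        rw [hxR]
        have : 2 * V ≤ ε * R := by
          rw [div_le_iff₀ hε] at hR; linarith
        nlinarith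
      linarith
  exact weak_max_principle hKc hUo hUK hc h2 ht hsub hbot hlat

/-- **One-sided comparison for the swirl** (the heart of the maximum principle (1.4) of
Lei–Zhang 2017 / KNSS 2009 (1.9)): under the hypotheses of `abs_swirl_le_of_classical`, for a
sign `σ = ±1`, `σ Γ(t, x) ≤ M` on `[0, T] × ℝ³`.  See the module docstring for the barrier
argument (the case `ν > 0` of `sign_mul_swirl_le_of_classical_of_nonneg`).
[cite: LeiZhang2017, §1 (1.3)–(1.4) (arXiv p. 3)] -/
theorem sign_mul_swirl_le_of_classical {T ν V M : ℝ} {v : ℝ → (EuclideanSpace ℝ (Fin 3)) → (EuclideanSpace ℝ (Fin 3))} {q : ℝ → (EuclideanSpace ℝ (Fin 3)) → ℝ}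
    (hν : 0 < ν) (hT : 0 < T) (hcl : IsClassicalNSSolutionOn (Icc 0 T) ν 0 v q)
    (haxi : ∀ t ∈ Icc 0 T, IsAxisymmetric (v t)) (hV : ∀ t ∈ Icc 0 T, ∀ x, ‖v t x‖ ≤ V)
    (hM : ∀ x, |swirl (v 0) x| ≤ M) {σ : ℝ} (hσ : σ = 1 ∨ σ = -1) :
    ∀ t ∈ Icc 0 T, ∀ x, σ * swirl (v t) x ≤ M :=
  sign_mul_swirl_le_of_classical_of_nonneg hν.le hT hcl haxi hV hM hσ

/-- **Maximum principle for the swirl, any `ν ≥ 0`** (Lei–Zhang 2017, (1.4); KNSS 2009, (1.9);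
for `ν = 0` the conservation of the swirl of axisymmetric Euler flows, Majda–Bertozzi (2.67)):
let `(v, q)` be a classical solution of the unforced system with viscosity `ν ≥ 0` on the closed
slab `[0, T] × ℝ³` with bounded (`|v| ≤ V`) axisymmetric velocity.  If `|Γ₀| ≤ M` then
`|Γ(t, x)| = |x₀v₁ − x₁v₀| ≤ M` for all `(t, x) ∈ [0, T] × ℝ³`.
[cite: LeiZhang2017, §1 (1.4) (arXiv p. 3); MajdaBertozziCUP2002, §2.3.3 (2.65)–(2.67)] -/
theorem abs_swirl_le_of_classical_of_nonneg {T ν V M : ℝ} {v : ℝ → (EuclideanSpace ℝ (Fin 3)) → (EuclideanSpace ℝ (Fin 3))} {q : ℝ → (EuclideanSpace ℝ (Fin 3)) → ℝ}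
    (hν : 0 ≤ ν) (hT : 0 < T) (hcl : IsClassicalNSSolutionOn (Icc 0 T) ν 0 v q)
    (haxi : ∀ t ∈ Icc 0 T, IsAxisymmetric (v t)) (hV : ∀ t ∈ Icc 0 T, ∀ x, ‖v t x‖ ≤ V)
    (hM : ∀ x, |swirl (v 0) x| ≤ M) :
    ∀ t ∈ Icc 0 T, ∀ x, |swirl (v t) x| ≤ M := by
  intro t ht x
  have h1 := sign_mul_swirl_le_of_classical_of_nonneg hν hT hcl haxi hV hM (Or.inl rfl) t ht x
  have h2 := sign_mul_swirl_le_of_classical_of_nonneg hν hT hcl haxi hV hM (Or.inr rfl) t ht x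
  rw [one_mul] at h1
  rw [neg_one_mul] at h2
  exact abs_le.2 ⟨by linarith, h1⟩

/-- **Maximum principle for the swirl** (Lei–Zhang 2017, (1.4); KNSS 2009, (1.9); Chae–Lee
2002): let `(v, q)` be a classical solution of the unforced Navier–Stokes system (`ν > 0`) on the
closed slab `[0, T] × ℝ³` with bounded (`|v| ≤ V`) axisymmetric velocity.  If `|Γ₀| ≤ M` then
`|Γ(t, x)| = |x₀v₁ − x₁v₀| ≤ M` for all `(t, x) ∈ [0, T] × ℝ³`. [cite: LeiZhang2017, §1 (1.4) (arXiv p. 3)] -/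
theorem abs_swirl_le_of_classical {T ν V M : ℝ} {v : ℝ → (EuclideanSpace ℝ (Fin 3)) → (EuclideanSpace ℝ (Fin 3))} {q : ℝ → (EuclideanSpace ℝ (Fin 3)) → ℝ}
    (hν : 0 < ν) (hT : 0 < T) (hcl : IsClassicalNSSolutionOn (Icc 0 T) ν 0 v q)
    (haxi : ∀ t ∈ Icc 0 T, IsAxisymmetric (v t)) (hV : ∀ t ∈ Icc 0 T, ∀ x, ‖v t x‖ ≤ V)
    (hM : ∀ x, |swirl (v 0) x| ≤ M) :
    ∀ t ∈ Icc 0 T, ∀ x, |swirl (v t) x| ≤ M :=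
  abs_swirl_le_of_classical_of_nonneg hν.le hT hcl haxi hV hM

/-- **Conservation of the swirl for axisymmetric Euler flows, `L^∞` form** (`ν = 0`): for smooth
axisymmetric solutions of the 3D Euler equations the swirl `Γ = r v^θ` is transported by the flow,
`D̃(r v^θ)/Dt = 0` — "conservation of circulation on material circles centered on the axis of
symmetry" (Majda–Bertozzi (2.65)–(2.67)) — so
`sup |Γ(t, ·)| ≤ sup |Γ₀|`.  Precisely: let `(v, q)` be a classical solution of the unforced Euler
system (`IsClassicalNSSolutionOn (Icc 0 T) 0 0 v q`, viscosity `0`, forcing `0`) on the closed slab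
`[0, T] × ℝ³` with bounded (`|v| ≤ V`) axisymmetric velocity; if `|Γ₀| ≤ M` then `|Γ(t, x)| ≤ M`
for all `(t, x) ∈ [0, T] × ℝ³`.  (The case `ν = 0` of `abs_swirl_le_of_classical_of_nonneg`: the
comparison argument needs no characteristics.)
[cite: MajdaBertozziCUP2002, §2.3.3 (2.65)–(2.67)] -/
theorem abs_swirl_le_of_classicalEuler {T V M : ℝ} {v : ℝ → (EuclideanSpace ℝ (Fin 3)) → (EuclideanSpace ℝ (Fin 3))} {q : ℝ → (EuclideanSpace ℝ (Fin 3)) → ℝ}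
    (hT : 0 < T) (hcl : IsClassicalNSSolutionOn (Icc 0 T) 0 0 v q)
    (haxi : ∀ t ∈ Icc 0 T, IsAxisymmetric (v t)) (hV : ∀ t ∈ Icc 0 T, ∀ x, ‖v t x‖ ≤ V)
    (hM : ∀ x, |swirl (v 0) x| ≤ M) :
    ∀ t ∈ Icc 0 T, ∀ x, |swirl (v t) x| ≤ M :=
  abs_swirl_le_of_classical_of_nonneg le_rfl hT hcl haxi hV hM

/-- **Maximum principle for the swirl in Tao's class** (Lei–Zhang 2017, (1.4), for the smooth
class in which the tree runs its continuation arguments): for a Tao-class solution on `[0, T]`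
(`ν > 0`, `T > 0`) with axisymmetric slices, `|Γ₀| ≤ M` implies `|Γ(t, x)| ≤ M` on
`[0, T] × ℝ³` (the velocity is bounded on the slab, `IsTaoSolutionOn.exists_bound_velocity`).
[cite: LeiZhang2017, §1 (1.4) (arXiv p. 3)] -/
theorem IsTaoSolutionOn.abs_swirl_le {T ν M : ℝ} {u₀ : (EuclideanSpace ℝ (Fin 3)) → (EuclideanSpace ℝ (Fin 3))} {v : ℝ → (EuclideanSpace ℝ (Fin 3)) → (EuclideanSpace ℝ (Fin 3))}
    {q : ℝ → (EuclideanSpace ℝ (Fin 3)) → ℝ} (h : IsTaoSolutionOn T ν u₀ v q) (hν : 0 < ν) (hT : 0 < T)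
    (haxi : ∀ t ∈ Icc 0 T, IsAxisymmetric (v t)) (hM : ∀ x, |swirl u₀ x| ≤ M) :
    ∀ t ∈ Icc 0 T, ∀ x, |swirl (v t) x| ≤ M := by
  obtain ⟨V, -, hV⟩ := h.exists_bound_velocity
  have hM' : ∀ x, |swirl (v 0) x| ≤ M := by rw [h.initial]; exact hM
  exact abs_swirl_le_of_classical hν hT h.classical haxi hV hM'

end Swirl

end Literature.Analysis.FluidPDE

end
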